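import Summits.QuantumFields.BalabanUV.T4Continuum.Support.NE7AccumulatedFrameDictionary
import Summits.QuantumFields.BalabanUV.T4Continuum.Support.NE7BlockFrameSecondOrder
import Summits.QuantumFields.BalabanUV.T4Continuum.Support.NE7AccumulatedFrameSecondOrder
import HarnessLib

/-!
# Support | NE7 (gen 97, ROAD-G96 §9∕§11, third brick of (Γ3), part 2 — THE SUP FORM): THE ACCUMULATED FRAME MINUS ITS LINEARISATION IS SECOND ORDER —
# `‖log v_k(z) − framePotW L k W X z‖ ≤ (56(dL)² + 16C₁dL)·(L^k·b)²` for `sup‖X‖ ≤ b` in the regime of [Balaban1985Averaging] Prop. 4 (`100·dL·L^k b ≤ 1`, `16C₁·L^k b ≤ 1`),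
# `v_k = vcov L W (relPert W X) k` the accumulated frame (97) — k-FREE constant, NO slice condition, NO frame condition; and the same with the commutator area `½Σ_{i<j}[F_i,F_j]` kept

Cell `pub-balaban`, rung (B)+1 sub-cell t4, lineage `b2b-balaban-t4-ne7-p1` (CRUX PROVER NE7 #1 = OWNER of row NE7), generation 97; memo `t4/b2b-balaban-t4-ne7-p1-g96/ROAD-G96.md`
§9 (Γ3) ∕ §10(ii) ∕ §11.  Pure assembly of part 1 (`NE7AccumulatedFrameDictionary`: `framePotW = Σ_m frameLin_m(QbarIter_m)`, the level dictionary with the Prop-4 sup letters)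
with this lineage's bricks 1–2 (`NE7BlockFrameSecondOrder.norm_Fcov_sub_frameLin_le_of_sup`: `‖Fcov L V₀ (e^{Ad ψ}) y − frameLin L V₀ ψ y‖ ≤ 2(dLβ)²`;
`NE7AccumulatedFrameSecondOrder.norm_mlog_vcov_sub_sum_sub_pairComm_le`: `‖log v_k − Σ_m Fcov_m − ½pairComm‖ ≤ 28S³`, `‖pairComm‖ ≤ S²`).

WHY (memo §7(a), §10(ii), §11).  The top pure gauge of the accumulated frame `v_{k+1}` is removed in ROAD-Γ by a gauge adjustment `u ↦ u·exp(η_zψ_z)` at the top corners with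
`η_z = log v_{k+1}(z)`; the ν-letter of the binder `hdecomp♭` needs `max_z ‖η_z − (first order)‖ ≤ C·(M·sup‖X‖)²` with a k-free `C` (memo §10(ii), last line), the first-order part
being the honest block-average reading `framePotW L (k+1) W X z` (zero on `T_♮`).  THIS FILE is that letter.  Bookkeeping: per level `‖Fcov_m − frameLin_m(QbarIter_m X)‖ ≤
2(dL·2L^m b)² + dL·16C₁(L^m b)²` (brick 1 + the frame of the Prop-4 remainder), `‖Fcov_m‖ ≤ 3dL·L^m b + 32C₁dL(L^m b)²`, level sums by `Σ_{m<k} L^m ≤ L^k`, `Σ_{m<k} L^{2m} ≤ L^{2k}`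
(`L ≥ 2`), `S = Σ_m ‖Fcov_m‖ ≤ 5dL·L^k b ≤ 1∕20`, then brick 2.  The sup-capped BILINEAR∕local-energy form of (Γ3) (the κ-letter's input) is NOT here (successor; it re-uses part 1
and the `pairComm` form below, whose commutator area is the multi-scale corner-charge polygon of memo §7(a)(3)).
WHAT ([folklore]; 0 def, 0 sorry).  §1 per-level letters in the Prop-4 regime at level `k`: **`norm_Fcov_sub_frameLin_QbarIter_le`** (every `m ≤ k` with `40dL·L^m b ≤ 1`, every site
`y`), `norm_Fcov_le`.  §2 **`norm_mlog_vcov_sub_framePotW_sub_pairComm_le`** (`∃ l`, `contourVar l = Σ_m Fcov_m(L^{k−m}z)`, `‖pairComm l‖ ≤ (5dL·L^k b)²`,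
`‖log v_k(z) − framePotW L k W X z − ½pairComm l‖ ≤ 28(5dL·L^k b)³ + (8(dL)² + 16C₁dL)(L^k b)²`) and **`norm_mlog_vcov_sub_framePotW_le`** (the display).
HONEST FRAMING (page 1): bookkeeping on OUR frame over landed kernel theorems; nothing of Bałaban's asserted; (Γ3)'s bilinear form, (Γ4), (Γ5), `hdecomp♭`, NE7 NOT proved; spine 0∕9;
finite T⁴ rung (B)+1 — NOT infinite volume, NOT mass gap, NOT `BetaPertH`, NOT Clay.  Continuum YM on T⁴ ⇐ BetaPertH ∧ nine spine estimates (0/9 proved); BetaPertH ⇐ (D1) ∧ (D4) ∧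
CAP+tail; G-an2-4 gates asym, D1 and NE2/3/4.
-/

set_option autoImplicit false

open scoped BigOperators Matrix Matrix.Norms.L2Operator
open NormedSpace Finset

namespace Summit.QuantumFields.BalabanUV.T4Continuum.NE7AccumulatedFrameLinearisation

open Literature.MathematicalPhysics.QuantumFieldTheory.Balaban1983to89
open B7Prop1Explicit B7Prop2Explicit B7Prop3Flat MatrixLog
open B7Eq92Concrete (vcov Fcov dbavgCovIter)
open B7Prop4GeneralLevels (logCovIter linCovIter)
open B14.Eq372ContourBCH (contourVar pairComm normSum)
open T4AveragingDeficitWall (Ad IsUnitaryCfg)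
open AveragingDeficitMultiLevelPrep (cavgIter)
open AveragingDeficitMultiLevelBridge (cavgIter_eq_avgIter)
open BlockAveragePushDirSplit (frameLin)
open NE3TangentCovariantTower (QbarIter framePotW)
open NE3.QbarDictionary (adField)
open NE3.PairLandauB8Avg (relPert)
open NE7BlockFrameSecondOrder (norm_Fcov_sub_frameLin_le_of_sup)
open NE7AccumulatedFrameSecondOrder (norm_mlog_vcov_sub_sum_sub_pairComm_le)
open NE7AccumulatedFrameDictionary (sum_pow_le_pow frameLin_sub norm_frameLin_le_of_sup framePotW_eq_sum_frameLin level_dictionary)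

noncomputable section

variable {d : ℕ} {n : Type*} [Fintype n] [DecidableEq n]

/-! ## §1 Per-level frame letters -/

/-- **ONE LEVEL OF THE ACCUMULATED FRAME AGAINST THE LINEAR FRAME OF THE LINEARISED FIELD**: in the Prop-4 regime at level `k`, for every `m ≤ k` with `40·dL·(L^m b) ≤ 1`
and every site `y`, `‖Fcov L W̄^m U̿^m y − frameLin L W̄^m (QbarIter L m W X) y‖ ≤ 8(dL)²(L^m b)² + 16C₁·dL·(L^m b)²` (brick 1's sup form with `β = 2L^m b`, plus the frame of the
Prop-4 remainder). [folklore] -/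
theorem norm_Fcov_sub_frameLin_QbarIter_le [Nonempty n] {L : ℕ} (hL : 2 ≤ L) (k : ℕ)
    {W : Site d → Fin d → (Matrix n n ℂ)ˣ} (hWu : IsUnitaryCfg W) {X : Site d → Fin d → Matrix n n ℂ}
    {α₀ b : ℝ} (hα : 0 < α₀) (hα3 : C0 d * α₀ ≤ 1 / 3) (hα4 : 4 * α₀ ≤ c2' d L)
    (h52 : pdev W < α₀ * (((L : ℝ) ^ k)⁻¹) ^ 2) (hb : 0 ≤ b) (hX : ∀ (y : Site d) (κ : Fin d), ‖X y κ‖ ≤ b)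
    (hsmall : Real.exp (4 * (800 * ((d : ℝ) + 1) ^ 2 * ((d : ℝ) + 4)) * α₀)
      * (1 + 8 * (131072 * ((d : ℝ) + 1) ^ 2) * ((L : ℝ) ^ k * b)) ≤ 2)
    (hc₃ : 2 * ((L : ℝ) ^ k * b) ≤ c3 d L) {m : ℕ} (hm : m ≤ k) (h40 : 40 * ((d : ℝ) * L * ((L : ℝ) ^ m * b)) ≤ 1) (y : Site d) :
    ‖Fcov L (avgIter L W m) (dbavgCovIter L W (relPert W X) m) y - frameLin L (avgIter L W m) (QbarIter L m W X) y‖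
      ≤ 8 * ((d : ℝ) * L) ^ 2 * ((L : ℝ) ^ m * b) ^ 2 + 16 * (131072 * ((d : ℝ) + 1) ^ 2) * ((d : ℝ) * L) * ((L : ℝ) ^ m * b) ^ 2 := by
  letI : CStarAlgebra (Matrix n n ℂ) := {}
  have hL1 : 1 ≤ L := by omega
  obtain ⟨hUm, hexpCfg, -, hsup, hrem⟩ := level_dictionary hL k hWu hα hα3 hα4 h52 hb hX hsmall hc₃ m hm
  set ψ : Site d → Fin d → Matrix n n ℂ := fun x μ => Ad (avgIter L W m x μ)⁻¹ (logCovIter L W (adField W X) m x μ) with hψ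
  have hβ0 : 0 ≤ 2 * ((L : ℝ) ^ m * b) := by positivity
  have hψsup : ∀ (x : Site d) (κ : Fin d), ‖ψ x κ‖ ≤ 2 * ((L : ℝ) ^ m * b) := hsup
  have hsm : (d : ℝ) * L * (2 * ((L : ℝ) ^ m * b)) ≤ 1 / 20 := by nlinarith
  -- brick 1, sup form
  have h1 : ‖Fcov L (avgIter L W m) (expCfg (fun x' μ' => Ad (avgIter L W m x' μ') (ψ x' μ'))) y - frameLin L (avgIter L W m) ψ y‖
      ≤ 2 * ((d : ℝ) * L * (2 * ((L : ℝ) ^ m * b))) ^ 2 :=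
    norm_Fcov_sub_frameLin_le_of_sup hL1 hUm hβ0 hψsup hsm y
  rw [← hexpCfg] at h1
  -- the frame of the Prop-4 remainder
  have h2 : ‖frameLin L (avgIter L W m) ψ y - frameLin L (avgIter L W m) (QbarIter L m W X) y‖
      ≤ (d : ℝ) * L * (16 * (131072 * ((d : ℝ) + 1) ^ 2) * ((L : ℝ) ^ m * b) ^ 2) := by
    rw [frameLin_sub]
    exact norm_frameLin_le_of_sup hL1 hUm (by positivity) (fun x κ => hrem x κ) y
  calc ‖Fcov L (avgIter L W m) (dbavgCovIter L W (relPert W X) m) y - frameLin L (avgIter L W m) (QbarIter L m W X) y‖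
      = ‖(Fcov L (avgIter L W m) (dbavgCovIter L W (relPert W X) m) y - frameLin L (avgIter L W m) ψ y)
          + (frameLin L (avgIter L W m) ψ y - frameLin L (avgIter L W m) (QbarIter L m W X) y)‖ := by rw [sub_add_sub_cancel]
    _ ≤ 2 * ((d : ℝ) * L * (2 * ((L : ℝ) ^ m * b))) ^ 2 + (d : ℝ) * L * (16 * (131072 * ((d : ℝ) + 1) ^ 2) * ((L : ℝ) ^ m * b) ^ 2) :=
        (norm_add_le _ _).trans (add_le_add h1 h2)
    _ = 8 * ((d : ℝ) * L) ^ 2 * ((L : ℝ) ^ m * b) ^ 2 + 16 * (131072 * ((d : ℝ) + 1) ^ 2) * ((d : ℝ) * L) * ((L : ℝ) ^ m * b) ^ 2 := by ring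

/-- **SUP OF ONE LEVEL OF THE ACCUMULATED FRAME**: in the same regime, for every `m ≤ k` with `40·dL·(L^m b) ≤ 1` and every `y`,
`‖Fcov L W̄^m U̿^m y‖ ≤ 3·dL·(L^m b) + 32C₁·dL·(L^m b)²` (`dL·2L^m b` from the linear frame of `QbarIter_m X` plus the second-order terms). [folklore] -/
theorem norm_Fcov_le [Nonempty n] {L : ℕ} (hL : 2 ≤ L) (k : ℕ)
    {W : Site d → Fin d → (Matrix n n ℂ)ˣ} (hWu : IsUnitaryCfg W) {X : Site d → Fin d → Matrix n n ℂ}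
    {α₀ b : ℝ} (hα : 0 < α₀) (hα3 : C0 d * α₀ ≤ 1 / 3) (hα4 : 4 * α₀ ≤ c2' d L)
    (h52 : pdev W < α₀ * (((L : ℝ) ^ k)⁻¹) ^ 2) (hb : 0 ≤ b) (hX : ∀ (y : Site d) (κ : Fin d), ‖X y κ‖ ≤ b)
    (hsmall : Real.exp (4 * (800 * ((d : ℝ) + 1) ^ 2 * ((d : ℝ) + 4)) * α₀)
      * (1 + 8 * (131072 * ((d : ℝ) + 1) ^ 2) * ((L : ℝ) ^ k * b)) ≤ 2)
    (hc₃ : 2 * ((L : ℝ) ^ k * b) ≤ c3 d L) {m : ℕ} (hm : m ≤ k) (h40 : 40 * ((d : ℝ) * L * ((L : ℝ) ^ m * b)) ≤ 1) (y : Site d) :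
    ‖Fcov L (avgIter L W m) (dbavgCovIter L W (relPert W X) m) y‖
      ≤ 3 * ((d : ℝ) * L * ((L : ℝ) ^ m * b)) + 32 * (131072 * ((d : ℝ) + 1) ^ 2) * ((d : ℝ) * L) * ((L : ℝ) ^ m * b) ^ 2 := by
  letI : CStarAlgebra (Matrix n n ℂ) := {}
  have hL1 : 1 ≤ L := by omega
  obtain ⟨hUm, -, -, hsup, hrem⟩ := level_dictionary hL k hWu hα hα3 hα4 h52 hb hX hsmall hc₃ m hm
  have hdiff := norm_Fcov_sub_frameLin_QbarIter_le hL k hWu hα hα3 hα4 h52 hb hX hsmall hc₃ hm h40 y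
  -- the linear frame of `QbarIter_m X`: sup `2L^m b + 16C₁(L^m b)²`
  have hQsup : ∀ (x : Site d) (κ : Fin d), ‖QbarIter L m W X x κ‖ ≤ 2 * ((L : ℝ) ^ m * b) + 16 * (131072 * ((d : ℝ) + 1) ^ 2) * ((L : ℝ) ^ m * b) ^ 2 := by
    intro x κ
    have e : QbarIter L m W X x κ = Ad (avgIter L W m x κ)⁻¹ (logCovIter L W (adField W X) m x κ)
        - (Ad (avgIter L W m x κ)⁻¹ (logCovIter L W (adField W X) m x κ) - QbarIter L m W X x κ) := by rw [sub_sub_cancel]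
    rw [e]
    exact (norm_sub_le _ _).trans (add_le_add (hsup x κ) (hrem x κ))
  have hlin : ‖frameLin L (avgIter L W m) (QbarIter L m W X) y‖
      ≤ (d : ℝ) * L * (2 * ((L : ℝ) ^ m * b) + 16 * (131072 * ((d : ℝ) + 1) ^ 2) * ((L : ℝ) ^ m * b) ^ 2) :=
    norm_frameLin_le_of_sup hL1 hUm (by positivity) hQsup y
  have htri : ‖Fcov L (avgIter L W m) (dbavgCovIter L W (relPert W X) m) y‖
      ≤ ‖Fcov L (avgIter L W m) (dbavgCovIter L W (relPert W X) m) y - frameLin L (avgIter L W m) (QbarIter L m W X) y‖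
        + ‖frameLin L (avgIter L W m) (QbarIter L m W X) y‖ := norm_le_norm_sub_add _ _
  set x : ℝ := (L : ℝ) ^ m * b with hx
  set s : ℝ := (d : ℝ) * L with hs
  have hx0 : 0 ≤ x := by positivity
  have hs0 : 0 ≤ s := by positivity
  have hsx : 40 * (s * x) ≤ 1 := h40
  -- `8(s x)² ≤ s x` since `40·s x ≤ 1`
  have hsq : 8 * s ^ 2 * x ^ 2 ≤ s * x := by nlinarith [mul_nonneg hs0 hx0]
  have hlin' : ‖frameLin L (avgIter L W m) (QbarIter L m W X) y‖ ≤ 2 * (s * x) + 16 * (131072 * ((d : ℝ) + 1) ^ 2) * s * x ^ 2 := by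
    rw [hs, hx]; linarith
  linarith

/-! ## §2 The accumulated frame minus the accumulated linear frame -/

/-- **THE ACCUMULATED FRAME MINUS ITS LINEARISATION IS SECOND ORDER (SUP FORM), WITH THE COMMUTATOR AREA KEPT**: in the Prop-4 regime at level `k` at a unitary `W` with
`sup‖X‖ ≤ b` and `100·dL·(L^k b) ≤ 1`, `16C₁·(L^k b) ≤ 1`, for every `z` there is the level-ordered list `l` of the one-block frames (`contourVar l = Σ_{m<k} Fcov_m(L^{k−m}z)`,
`‖pairComm l‖ ≤ (5dL·L^k b)²`) with `‖log v_k(z) − framePotW L k W X z − ½·pairComm l‖ ≤ 28(5dL·L^k b)³ + (8(dL)² + 16C₁dL)·(L^k b)²`. [folklore] -/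
theorem norm_mlog_vcov_sub_framePotW_sub_pairComm_le [Nonempty n] {L : ℕ} (hL : 2 ≤ L) (k : ℕ)
    {W : Site d → Fin d → (Matrix n n ℂ)ˣ} (hWu : IsUnitaryCfg W) {X : Site d → Fin d → Matrix n n ℂ}
    {α₀ b : ℝ} (hα : 0 < α₀) (hα3 : C0 d * α₀ ≤ 1 / 3) (hα4 : 4 * α₀ ≤ c2' d L)
    (h52 : pdev W < α₀ * (((L : ℝ) ^ k)⁻¹) ^ 2) (hb : 0 ≤ b) (hX : ∀ (y : Site d) (κ : Fin d), ‖X y κ‖ ≤ b)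
    (hsmall : Real.exp (4 * (800 * ((d : ℝ) + 1) ^ 2 * ((d : ℝ) + 4)) * α₀)
      * (1 + 8 * (131072 * ((d : ℝ) + 1) ^ 2) * ((L : ℝ) ^ k * b)) ≤ 2)
    (hc₃ : 2 * ((L : ℝ) ^ k * b) ≤ c3 d L) (h100 : 100 * ((d : ℝ) * L * ((L : ℝ) ^ k * b)) ≤ 1)
    (hC16 : 16 * (131072 * ((d : ℝ) + 1) ^ 2) * ((L : ℝ) ^ k * b) ≤ 1) (z : Site d) :
    ∃ l : List (Matrix n n ℂ),
      contourVar l = ∑ m ∈ range k, Fcov L (avgIter L W m) (dbavgCovIter L W (relPert W X) m) (((L : ℤ) ^ (k - m)) • z) ∧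
      ‖pairComm l‖ ≤ (5 * ((d : ℝ) * L * ((L : ℝ) ^ k * b))) ^ 2 ∧
      ‖mlog ((vcov L W (relPert W X) k z : (Matrix n n ℂ)ˣ) : Matrix n n ℂ) - framePotW L k W X z - (2⁻¹ : ℂ) • pairComm l‖
        ≤ 28 * (5 * ((d : ℝ) * L * ((L : ℝ) ^ k * b))) ^ 3
          + (8 * ((d : ℝ) * L) ^ 2 + 16 * (131072 * ((d : ℝ) + 1) ^ 2) * ((d : ℝ) * L)) * ((L : ℝ) ^ k * b) ^ 2 := by
  letI : CStarAlgebra (Matrix n n ℂ) := {}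
  have hL1 : 1 ≤ L := by omega
  have hLR : (2 : ℝ) ≤ L := by exact_mod_cast hL
  have hL0 : (0 : ℝ) < L := by linarith
  set β : ℝ := (L : ℝ) ^ k * b with hβ
  set t : ℝ := (d : ℝ) * L * β with ht
  have hβ0 : 0 ≤ β := by positivity
  have ht0 : 0 ≤ t := by positivity
  set C₁ : ℝ := 131072 * ((d : ℝ) + 1) ^ 2 with hC₁
  have hC₁0 : 0 ≤ C₁ := by positivity
  -- level sizes: `L^m b ≤ β` and `Σ_{m<k} L^m b ≤ β`, `Σ_{m<k} (L^m b)² ≤ β²`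
  have hLm_le : ∀ m ≤ k, (L : ℝ) ^ m * b ≤ β := fun m hm =>
    mul_le_mul_of_nonneg_right (pow_le_pow_right₀ (by linarith) hm) hb
  have hsum1 : ∑ m ∈ range k, (L : ℝ) ^ m * b ≤ β := by
    rw [← Finset.sum_mul]; exact mul_le_mul_of_nonneg_right (sum_pow_le_pow hLR k) hb
  have hsum2 : ∑ m ∈ range k, ((L : ℝ) ^ m * b) ^ 2 ≤ β ^ 2 := by
    have h2 : ∑ m ∈ range k, ((L : ℝ) ^ m * b) ^ 2 = (∑ m ∈ range k, ((L : ℝ) ^ 2) ^ m) * b ^ 2 := by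
      rw [Finset.sum_mul]; refine Finset.sum_congr rfl fun m _ => ?_; rw [← pow_mul, mul_comm 2 m, pow_mul]; ring
    rw [h2, hβ, mul_pow, ← pow_mul, mul_comm k 2, pow_mul]
    exact mul_le_mul_of_nonneg_right (sum_pow_le_pow (by nlinarith) k) (sq_nonneg _)
  have h40 : ∀ m ≤ k, 40 * ((d : ℝ) * L * ((L : ℝ) ^ m * b)) ≤ 1 := by
    intro m hm
    have := mul_le_mul_of_nonneg_left (hLm_le m hm) (by positivity : (0 : ℝ) ≤ (d : ℝ) * L)
    nlinarith
  -- per-level letters along the corner chain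
  have hdiff : ∀ m ∈ range k,
      ‖Fcov L (avgIter L W m) (dbavgCovIter L W (relPert W X) m) (((L : ℤ) ^ (k - m)) • z)
          - frameLin L (avgIter L W m) (QbarIter L m W X) (((L : ℤ) ^ (k - m)) • z)‖
        ≤ (8 * ((d : ℝ) * L) ^ 2 + 16 * C₁ * ((d : ℝ) * L)) * ((L : ℝ) ^ m * b) ^ 2 := by
    intro m hm
    have hmk : m ≤ k := (Finset.mem_range.mp hm).le
    have h := norm_Fcov_sub_frameLin_QbarIter_le hL k hWu hα hα3 hα4 h52 hb hX hsmall hc₃ hmk (h40 m hmk) (((L : ℤ) ^ (k - m)) • z)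
    rw [hC₁]; linarith
  have hFsup : ∀ m ∈ range k,
      ‖Fcov L (avgIter L W m) (dbavgCovIter L W (relPert W X) m) (((L : ℤ) ^ (k - m)) • z)‖ ≤ 5 * ((d : ℝ) * L) * ((L : ℝ) ^ m * b) := by
    intro m hm
    have hmk : m ≤ k := (Finset.mem_range.mp hm).le
    have h := norm_Fcov_le hL k hWu hα hα3 hα4 h52 hb hX hsmall hc₃ hmk (h40 m hmk) (((L : ℤ) ^ (k - m)) • z)
    -- `32C₁·dL·(L^m b)² = 2dL(L^m b)·(16C₁ L^m b) ≤ 2dL(L^m b)` by `hC16` and `L^m b ≤ β`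
    have hx0 : 0 ≤ (L : ℝ) ^ m * b := by positivity
    have h16 : 16 * C₁ * ((L : ℝ) ^ m * b) ≤ 1 := by
      rw [hC₁]; exact (mul_le_mul_of_nonneg_left (hLm_le m hmk) (by positivity)).trans hC16
    have hdl : 0 ≤ (d : ℝ) * L := by positivity
    have h32 : 32 * C₁ * ((d : ℝ) * L) * ((L : ℝ) ^ m * b) ^ 2 ≤ 2 * ((d : ℝ) * L) * ((L : ℝ) ^ m * b) := by
      have := mul_le_mul_of_nonneg_left h16 (mul_nonneg hdl hx0)
      nlinarith
    rw [hC₁] at h32; nlinarith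
  -- `S ≤ 5dL·β = 5t ≤ 1∕20`
  have hS : ∑ m ∈ range k, ‖Fcov L (avgIter L W m) (dbavgCovIter L W (relPert W X) m) (((L : ℤ) ^ (k - m)) • z)‖ ≤ 5 * t := by
    calc ∑ m ∈ range k, ‖Fcov L (avgIter L W m) (dbavgCovIter L W (relPert W X) m) (((L : ℤ) ^ (k - m)) • z)‖
        ≤ ∑ m ∈ range k, 5 * ((d : ℝ) * L) * ((L : ℝ) ^ m * b) := Finset.sum_le_sum hFsup
      _ = 5 * ((d : ℝ) * L) * ∑ m ∈ range k, (L : ℝ) ^ m * b := by rw [Finset.mul_sum]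
      _ ≤ 5 * ((d : ℝ) * L) * β := mul_le_mul_of_nonneg_left hsum1 (by positivity)
      _ = 5 * t := by rw [ht]; ring
  have hS20 : ∑ m ∈ range k, ‖Fcov L (avgIter L W m) (dbavgCovIter L W (relPert W X) m) (((L : ℤ) ^ (k - m)) • z)‖ ≤ 1 / 20 := by
    nlinarith
  have hS0 : 0 ≤ ∑ m ∈ range k, ‖Fcov L (avgIter L W m) (dbavgCovIter L W (relPert W X) m) (((L : ℤ) ^ (k - m)) • z)‖ :=
    Finset.sum_nonneg fun m _ => norm_nonneg _
  -- brick 2 with the commutator area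
  obtain ⟨l, hc, hp, h3⟩ := norm_mlog_vcov_sub_sum_sub_pairComm_le L W (relPert W X) k z hS20
  refine ⟨l, hc, ?_, ?_⟩
  · exact hp.trans (pow_le_pow_left₀ hS0 hS 2)
  · -- the dictionary and the per-level letters
    have hfp := framePotW_eq_sum_frameLin L W X k z
    have hD : ‖∑ m ∈ range k, Fcov L (avgIter L W m) (dbavgCovIter L W (relPert W X) m) (((L : ℤ) ^ (k - m)) • z) - framePotW L k W X z‖
        ≤ (8 * ((d : ℝ) * L) ^ 2 + 16 * C₁ * ((d : ℝ) * L)) * β ^ 2 := by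
      rw [hfp]
      have e : ∑ m ∈ range k, frameLin L (cavgIter L m W) (QbarIter L m W X) (((L : ℤ) ^ (k - m)) • z)
          = ∑ m ∈ range k, frameLin L (avgIter L W m) (QbarIter L m W X) (((L : ℤ) ^ (k - m)) • z) :=
        Finset.sum_congr rfl fun m _ => by rw [cavgIter_eq_avgIter]
      rw [e, ← Finset.sum_sub_distrib]
      calc ‖∑ m ∈ range k, (Fcov L (avgIter L W m) (dbavgCovIter L W (relPert W X) m) (((L : ℤ) ^ (k - m)) • z)
              - frameLin L (avgIter L W m) (QbarIter L m W X) (((L : ℤ) ^ (k - m)) • z))‖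
          ≤ ∑ m ∈ range k, (8 * ((d : ℝ) * L) ^ 2 + 16 * C₁ * ((d : ℝ) * L)) * ((L : ℝ) ^ m * b) ^ 2 :=
            (norm_sum_le _ _).trans (Finset.sum_le_sum hdiff)
        _ = (8 * ((d : ℝ) * L) ^ 2 + 16 * C₁ * ((d : ℝ) * L)) * ∑ m ∈ range k, ((L : ℝ) ^ m * b) ^ 2 := by rw [Finset.mul_sum]
        _ ≤ (8 * ((d : ℝ) * L) ^ 2 + 16 * C₁ * ((d : ℝ) * L)) * β ^ 2 := mul_le_mul_of_nonneg_left hsum2 (by positivity)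
    set M₀ : Matrix n n ℂ := mlog ((vcov L W (relPert W X) k z : (Matrix n n ℂ)ˣ) : Matrix n n ℂ) with hM₀
    set Ssum : Matrix n n ℂ := ∑ m ∈ range k, Fcov L (avgIter L W m) (dbavgCovIter L W (relPert W X) m) (((L : ℤ) ^ (k - m)) • z) with hSsum
    have hcub : 28 * (∑ m ∈ range k, ‖Fcov L (avgIter L W m) (dbavgCovIter L W (relPert W X) m) (((L : ℤ) ^ (k - m)) • z)‖) ^ 3
        ≤ 28 * (5 * t) ^ 3 := mul_le_mul_of_nonneg_left (pow_le_pow_left₀ hS0 hS 3) (by norm_num)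
    calc ‖M₀ - framePotW L k W X z - (2⁻¹ : ℂ) • pairComm l‖
        = ‖(M₀ - Ssum - (2⁻¹ : ℂ) • pairComm l) + (Ssum - framePotW L k W X z)‖ := by congr 1; abel
      _ ≤ 28 * (5 * t) ^ 3 + (8 * ((d : ℝ) * L) ^ 2 + 16 * C₁ * ((d : ℝ) * L)) * β ^ 2 :=
          (norm_add_le _ _).trans (add_le_add (h3.trans hcub) hD)
      _ = 28 * (5 * ((d : ℝ) * L * ((L : ℝ) ^ k * b))) ^ 3
          + (8 * ((d : ℝ) * L) ^ 2 + 16 * (131072 * ((d : ℝ) + 1) ^ 2) * ((d : ℝ) * L)) * ((L : ℝ) ^ k * b) ^ 2 := by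
          rw [ht, hβ, hC₁]

/-- **THE ACCUMULATED FRAME MINUS ITS LINEARISATION IS SECOND ORDER (SUP FORM)**: in the Prop-4 regime at level `k` at a unitary `W` with `sup‖X‖ ≤ b`, `100·dL·(L^k b) ≤ 1` and
`16C₁·(L^k b) ≤ 1`: for every `z`, `‖log v_k(z) − framePotW L k W X z‖ ≤ (56(dL)² + 16C₁dL)·(L^k b)²`, `v_k = vcov L W (relPert W X) k`, `C₁ = 131072(d+1)²` — k-FREE; on the slice
`T_♮` (`framePotW L k W X = 0`) this is `‖log v_k(z)‖ ≤ C·(L^k·sup‖X‖)²`, the ν-letter's input (memo §10(ii)). [folklore] -/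
theorem norm_mlog_vcov_sub_framePotW_le [Nonempty n] {L : ℕ} (hL : 2 ≤ L) (k : ℕ)
    {W : Site d → Fin d → (Matrix n n ℂ)ˣ} (hWu : IsUnitaryCfg W) {X : Site d → Fin d → Matrix n n ℂ}
    {α₀ b : ℝ} (hα : 0 < α₀) (hα3 : C0 d * α₀ ≤ 1 / 3) (hα4 : 4 * α₀ ≤ c2' d L)
    (h52 : pdev W < α₀ * (((L : ℝ) ^ k)⁻¹) ^ 2) (hb : 0 ≤ b) (hX : ∀ (y : Site d) (κ : Fin d), ‖X y κ‖ ≤ b)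
    (hsmall : Real.exp (4 * (800 * ((d : ℝ) + 1) ^ 2 * ((d : ℝ) + 4)) * α₀)
      * (1 + 8 * (131072 * ((d : ℝ) + 1) ^ 2) * ((L : ℝ) ^ k * b)) ≤ 2)
    (hc₃ : 2 * ((L : ℝ) ^ k * b) ≤ c3 d L) (h100 : 100 * ((d : ℝ) * L * ((L : ℝ) ^ k * b)) ≤ 1)
    (hC16 : 16 * (131072 * ((d : ℝ) + 1) ^ 2) * ((L : ℝ) ^ k * b) ≤ 1) (z : Site d) :
    ‖mlog ((vcov L W (relPert W X) k z : (Matrix n n ℂ)ˣ) : Matrix n n ℂ) - framePotW L k W X z‖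
      ≤ (56 * ((d : ℝ) * L) ^ 2 + 16 * (131072 * ((d : ℝ) + 1) ^ 2) * ((d : ℝ) * L)) * ((L : ℝ) ^ k * b) ^ 2 := by
  letI : CStarAlgebra (Matrix n n ℂ) := {}
  obtain ⟨l, -, hp, h3⟩ := norm_mlog_vcov_sub_framePotW_sub_pairComm_le hL k hWu hα hα3 hα4 h52 hb hX hsmall hc₃ h100 hC16 z
  set t : ℝ := (d : ℝ) * L * ((L : ℝ) ^ k * b) with ht
  have ht0 : 0 ≤ t := by positivity
  have ht100 : 100 * t ≤ 1 := h100
  have hhalf : ‖(2⁻¹ : ℂ) • pairComm l‖ ≤ 1 / 2 * (5 * t) ^ 2 := by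
    rw [norm_smul]
    have : ‖(2⁻¹ : ℂ)‖ = 1 / 2 := by simp
    rw [this]
    exact mul_le_mul_of_nonneg_left hp (by norm_num)
  set M₀ : Matrix n n ℂ := mlog ((vcov L W (relPert W X) k z : (Matrix n n ℂ)ˣ) : Matrix n n ℂ) - framePotW L k W X z with hM₀
  set C₁ : ℝ := 131072 * ((d : ℝ) + 1) ^ 2 with hC₁
  have e1 : (8 * ((d : ℝ) * L) ^ 2 + 16 * C₁ * ((d : ℝ) * L)) * ((L : ℝ) ^ k * b) ^ 2
      = 8 * t ^ 2 + 16 * C₁ * ((d : ℝ) * L) * ((L : ℝ) ^ k * b) ^ 2 := by rw [ht]; ring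
  have e2 : (56 * ((d : ℝ) * L) ^ 2 + 16 * C₁ * ((d : ℝ) * L)) * ((L : ℝ) ^ k * b) ^ 2
      = 56 * t ^ 2 + 16 * C₁ * ((d : ℝ) * L) * ((L : ℝ) ^ k * b) ^ 2 := by rw [ht]; ring
  -- `28·125·t³ ≤ 35t²` since `100t ≤ 1`
  have hcube : 28 * (5 * t) ^ 3 ≤ 35 * t ^ 2 := by nlinarith [mul_le_mul_of_nonneg_left ht100 (sq_nonneg t)]
  calc ‖M₀‖ = ‖(M₀ - (2⁻¹ : ℂ) • pairComm l) + (2⁻¹ : ℂ) • pairComm l‖ := by rw [sub_add_cancel]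
    _ ≤ (28 * (5 * t) ^ 3 + (8 * ((d : ℝ) * L) ^ 2 + 16 * C₁ * ((d : ℝ) * L)) * ((L : ℝ) ^ k * b) ^ 2)
          + 1 / 2 * (5 * t) ^ 2 := (norm_add_le _ _).trans (add_le_add h3 hhalf)
    _ ≤ (56 * ((d : ℝ) * L) ^ 2 + 16 * C₁ * ((d : ℝ) * L)) * ((L : ℝ) ^ k * b) ^ 2 := by
        rw [e1, e2]; nlinarith [sq_nonneg t]

end

end Summit.QuantumFields.BalabanUV.T4Continuum.NE7AccumulatedFrameLinearisation
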